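import Literature.Analysis.FunctionSpaces.TorusLiftDerivBounds
import Literature.Analysis.FunctionSpaces.TorusDerivBounds
import Literature.MathematicalPhysics.KineticTheory.HardSphereEuler
import Mathlib.Analysis.SpecialFunctions.Pow.Deriv

/-!
# Reference jets I: from Fréchet bounds on the lift to iterated partial derivatives on `𝕋³`

Helper file for the line `log-lipschitz-budget` of the crux `ImplosionDichotomy.PolynomialCompression`
(stmt-AtomisticToContinuum-12587), stub `stub_logBudgetShadowing`. The common hypotheses
`ShadowSetting` of the `H³` shadowing estimate control the reference implosion profile `(ρ₁, u₁, θ₁)`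
through sup bounds on the FRÉCHET derivatives `‖Dⁿ(ρ₁(t) ∘ proj)‖`, `‖Dⁿ(u₁(t) ∘ proj)‖` (`n ≤ 6`) of
the periodic lifts, while the level-`k` energy identities (`shadowE1`–`shadowE3`) are written with
NESTED torus partial derivatives `∂ᵢ(∂ⱼ(⋯ f))`. This file is the (Euler-free) bridge:

* `torus_norm_iteratedFDeriv_lift_partialDeriv_le` — `‖Dᵏ((∂ᵢf)∘proj)‖ ≤ ‖Dᵏ⁺¹(f∘proj)‖` (the lift
  of `∂ᵢf` is `D(f∘proj)[eᵢ]`), iterated along a list of directions in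
  `torus_norm_iteratedFDeriv_lift_iterPartialDeriv_le` / `torus_norm_iterPartialDeriv_le_norm_iteratedFDeriv_lift`
  (`‖∂^l f(proj y)‖ ≤ ‖D^{|l|}(f∘proj)(y)‖`);
* `torus_partialDeriv_iter_le_of_lift_bounds` (registered shape, real-valued, orders `1–4`) and
  `torus_partialDeriv_iter_le_of_lift_bounds_vec` (`V3`-valued fields and their components, orders `0–4`);
* the isentropic ingredient: for a smooth `f ≥ m > 0` with `‖Dᵏ(f∘proj)‖ ≤ S` (`k ≤ n`) and `|p| ≤ 1`,
  Faà di Bruno (Mathlib's `norm_iteratedFDeriv_comp_le'`) with the explicit derivatives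
  `(r^p)⁽ⁱ⁾ = p(p-1)⋯(p-i+1) r^{p-i}`, `|p(p-1)⋯(p-i+1)| ≤ i!`, `r^{p-i} ≤ (1+S)(1+m⁻¹)^{i+1}` gives
  `‖Dⁿ((a f^p)∘proj)‖ ≤ n!·|a| n!(1+S)(1+m⁻¹)ⁿ⁺¹·(1+S)ⁿ` (`torus_norm_iteratedFDeriv_lift_const_mul_rpow_le`),
  whence all torus derivatives of orders `0–4` of `a f^p` (resp. `f^p`) are at most
  `576 |a| (1+S)⁵ (1+m⁻¹)⁵` (`torus_rpow_jet_le_of_lift_bounds`, `torus_rpow_jet_le_of_lift_bounds'`);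
  used downstream with `p = 2/3` (`θ₁ = K ρ₁^{2/3}`), `1/3` (`c₁ = ρ₁^{1/3}`), `-1`, `-1/3` (inverse weights).
-/

noncomputable section

namespace Summit.AtomisticToContinuum.HydrodynamicLimit.Theorems

open Set MeasureTheory
open scoped ContDiff
open Literature.MathematicalPhysics.KineticTheory Literature.Analysis.FunctionSpaces

/-! ## The lift of a partial derivative: one Fréchet order down -/

/-- **Shift lemma**: for smooth `f : 𝕋³ → F`, `‖Dᵏ((∂ᵢf) ∘ proj)(y)‖ ≤ ‖Dᵏ⁺¹(f ∘ proj)(y)‖`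
(the lift of `∂ᵢf` is `y ↦ D(f∘proj)(y)[eᵢ]`, `‖eᵢ‖ = 1`; Mathlib `norm_iteratedFDeriv_clm_apply_const`,
`norm_iteratedFDeriv_fderiv`). [folklore] -/
theorem torus_norm_iteratedFDeriv_lift_partialDeriv_le :
    ∀ {F : Type} [NormedAddCommGroup F] [NormedSpace ℝ F] {f : T3 → F}, Torus.IsSmooth f →
      ∀ (i : Fin 3) (k : ℕ) (y : EuclideanSpace ℝ (Fin 3)),
        ‖iteratedFDeriv ℝ k (Torus.lift (Torus.partialDeriv i f)) y‖ ≤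
          ‖iteratedFDeriv ℝ (k + 1) (Torus.lift f) y‖ := by
  intro F _ _ f hf i k y
  have h1 : Torus.IsContDiff 1 f := hf.isContDiff (by simp)
  have hl : Torus.lift (Torus.partialDeriv i f) =
      fun y => fderiv ℝ (Torus.lift f) y (EuclideanSpace.single i (1 : ℝ)) :=
    Torus.lift_lineDeriv h1 _
  rw [hl]
  have hD : ContDiff ℝ k (fderiv ℝ (Torus.lift f)) := hf.fderiv_right (m := k) (by exact_mod_cast le_top)
  calc ‖iteratedFDeriv ℝ k (fun y => fderiv ℝ (Torus.lift f) y (EuclideanSpace.single i (1 : ℝ))) y‖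
      ≤ ‖(EuclideanSpace.single i (1 : ℝ) : EuclideanSpace ℝ (Fin 3))‖ *
          ‖iteratedFDeriv ℝ k (fderiv ℝ (Torus.lift f)) y‖ :=
        norm_iteratedFDeriv_clm_apply_const hD.contDiffAt (by exact_mod_cast le_rfl)
    _ = ‖iteratedFDeriv ℝ (k + 1) (Torus.lift f) y‖ := by
        rw [norm_iteratedFDeriv_fderiv, EuclideanSpace.single, PiLp.norm_single, norm_one, one_mul]

/-- **Iterated shift**: `‖Dᵏ((∂^l f) ∘ proj)(y)‖ ≤ ‖D^{k+|l|}(f ∘ proj)(y)‖` for the iterated partial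
derivative along a list `l` of directions. [folklore] -/
theorem torus_norm_iteratedFDeriv_lift_iterPartialDeriv_le :
    ∀ {F : Type} [NormedAddCommGroup F] [NormedSpace ℝ F] {f : T3 → F}, Torus.IsSmooth f →
      ∀ (l : List (Fin 3)) (k : ℕ) (y : EuclideanSpace ℝ (Fin 3)),
        ‖iteratedFDeriv ℝ k (Torus.lift (Torus.iterPartialDeriv l f)) y‖ ≤
          ‖iteratedFDeriv ℝ (k + l.length) (Torus.lift f) y‖ := by
  intro F _ _ f hf l
  induction l with
  | nil => intro k y; simp
  | cons i l ih =>
    intro k y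
    rw [Torus.iterPartialDeriv_cons, List.length_cons]
    calc ‖iteratedFDeriv ℝ k (Torus.lift (Torus.partialDeriv i (Torus.iterPartialDeriv l f))) y‖
        ≤ ‖iteratedFDeriv ℝ (k + 1) (Torus.lift (Torus.iterPartialDeriv l f)) y‖ :=
          torus_norm_iteratedFDeriv_lift_partialDeriv_le (hf.iterPartialDeriv l) i k y
      _ ≤ ‖iteratedFDeriv ℝ (k + 1 + l.length) (Torus.lift f) y‖ := ih (k + 1) y
      _ = ‖iteratedFDeriv ℝ (k + (l.length + 1)) (Torus.lift f) y‖ := by rw [add_assoc, add_comm 1]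

/-- **Read-out**: `‖∂^l f(proj y)‖ ≤ ‖D^{|l|}(f ∘ proj)(y)‖`. [folklore] -/
theorem torus_norm_iterPartialDeriv_le_norm_iteratedFDeriv_lift :
    ∀ {F : Type} [NormedAddCommGroup F] [NormedSpace ℝ F] {f : T3 → F}, Torus.IsSmooth f →
      ∀ (l : List (Fin 3)) (y : EuclideanSpace ℝ (Fin 3)),
        ‖Torus.iterPartialDeriv l f (Torus.proj y)‖ ≤ ‖iteratedFDeriv ℝ l.length (Torus.lift f) y‖ := by
  intro F _ _ f hf l y
  have h := torus_norm_iteratedFDeriv_lift_iterPartialDeriv_le hf l 0 y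
  rwa [norm_iteratedFDeriv_zero, Torus.lift_apply, zero_add] at h

/-- **Sup form**: a uniform bound `B` on `‖Dⁿ(f ∘ proj)‖` bounds every iterated partial derivative of
order `n` everywhere on the torus. [folklore] -/
theorem torus_norm_iterPartialDeriv_le_of_lift_bound :
    ∀ {F : Type} [NormedAddCommGroup F] [NormedSpace ℝ F] {f : T3 → F}, Torus.IsSmooth f →
      ∀ {n : ℕ} {B : ℝ}, (∀ y : EuclideanSpace ℝ (Fin 3), ‖iteratedFDeriv ℝ n (Torus.lift f) y‖ ≤ B) →
      ∀ (l : List (Fin 3)), l.length = n → ∀ x : T3, ‖Torus.iterPartialDeriv l f x‖ ≤ B := by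
  intro F _ _ f hf n B hB l hl x
  obtain ⟨y, rfl⟩ := Torus.proj_surjective x
  exact (torus_norm_iterPartialDeriv_le_norm_iteratedFDeriv_lift hf l y).trans (hl ▸ hB y)

/-- **Lift → torus bridge, orders `1–4`, real-valued** (registered helper): if
`‖Dⁿ(f ∘ proj)‖ ≤ M n` for all `n ≤ 4` then `|∂ᵢf| ≤ M 1`, `|∂ᵢ∂ⱼf| ≤ M 2`, `|∂ᵢ∂ⱼ∂ₖf| ≤ M 3`,
`|∂ᵢ∂ⱼ∂ₖ∂ₗf| ≤ M 4` everywhere (nested `Torus.partialDeriv` spelling of `shadowE2`/`shadowE3`). [folklore] -/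
theorem torus_partialDeriv_iter_le_of_lift_bounds :
    ∀ {f : T3 → ℝ}, Torus.IsSmooth f → ∀ {M : ℕ → ℝ},
      (∀ n : ℕ, n ≤ 4 → ∀ y : EuclideanSpace ℝ (Fin 3), ‖iteratedFDeriv ℝ n (Torus.lift f) y‖ ≤ M n) →
      ∀ (x : T3) (i j k l : Fin 3),
        |Torus.partialDeriv i f x| ≤ M 1 ∧
        |Torus.partialDeriv i (Torus.partialDeriv j f) x| ≤ M 2 ∧
        |Torus.partialDeriv i (Torus.partialDeriv j (Torus.partialDeriv k f)) x| ≤ M 3 ∧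
        |Torus.partialDeriv i (Torus.partialDeriv j (Torus.partialDeriv k (Torus.partialDeriv l f))) x| ≤
          M 4 := by
  intro f hf M hM x i j k l
  refine ⟨?_, ?_, ?_, ?_⟩
  · simpa using torus_norm_iterPartialDeriv_le_of_lift_bound hf (hM 1 (by norm_num)) [i] rfl x
  · simpa using torus_norm_iterPartialDeriv_le_of_lift_bound hf (hM 2 (by norm_num)) [i, j] rfl x
  · simpa using torus_norm_iterPartialDeriv_le_of_lift_bound hf (hM 3 (by norm_num)) [i, j, k] rfl x
  · simpa using torus_norm_iterPartialDeriv_le_of_lift_bound hf (hM 4 (by norm_num)) [i, j, k, l] rfl x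

/-- **Components cost nothing**: `‖Dⁿ((x ↦ u x c) ∘ proj)(y)‖ ≤ ‖Dⁿ(u ∘ proj)(y)‖` for a smooth
`V3`-valued field (`‖proj_c‖ ≤ 1`). [folklore] -/
theorem torus_norm_iteratedFDeriv_lift_coord_le :
    ∀ {u : T3 → V3}, Torus.IsSmooth u → ∀ (c : Fin 3) (n : ℕ) (y : EuclideanSpace ℝ (Fin 3)),
      ‖iteratedFDeriv ℝ n (Torus.lift (fun x => u x c)) y‖ ≤ ‖iteratedFDeriv ℝ n (Torus.lift u) y‖ := by
  intro u hu c n y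
  have hl : Torus.lift (fun x => u x c) = (EuclideanSpace.proj c : V3 →L[ℝ] ℝ) ∘ Torus.lift u := rfl
  rw [hl]
  refine ((EuclideanSpace.proj c : V3 →L[ℝ] ℝ).norm_iteratedFDeriv_comp_left hu.contDiffAt
    (by exact_mod_cast le_top)).trans ?_
  have hn : ‖(EuclideanSpace.proj c : V3 →L[ℝ] ℝ)‖ ≤ 1 := by
    refine ContinuousLinearMap.opNorm_le_bound _ zero_le_one fun v => ?_
    rw [one_mul]
    exact PiLp.norm_apply_le v c
  calc ‖(EuclideanSpace.proj c : V3 →L[ℝ] ℝ)‖ * ‖iteratedFDeriv ℝ n (Torus.lift u) y‖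
      ≤ 1 * ‖iteratedFDeriv ℝ n (Torus.lift u) y‖ := mul_le_mul_of_nonneg_right hn (norm_nonneg _)
    _ = _ := one_mul _

/-- **Lift → torus bridge for `V3`-valued fields, orders `0–4`**: the field, its nested partial
derivatives (in the `V3` norm) and those of every component `x ↦ u x c` are bounded by `M n`. [folklore] -/
theorem torus_partialDeriv_iter_le_of_lift_bounds_vec :
    ∀ {u : T3 → V3}, Torus.IsSmooth u → ∀ {M : ℕ → ℝ},
      (∀ n : ℕ, n ≤ 4 → ∀ y : EuclideanSpace ℝ (Fin 3), ‖iteratedFDeriv ℝ n (Torus.lift u) y‖ ≤ M n) →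
      ∀ (x : T3) (i j k l c : Fin 3),
        (‖u x‖ ≤ M 0 ∧ ‖Torus.partialDeriv i u x‖ ≤ M 1 ∧
          ‖Torus.partialDeriv i (Torus.partialDeriv j u) x‖ ≤ M 2 ∧
          ‖Torus.partialDeriv i (Torus.partialDeriv j (Torus.partialDeriv k u)) x‖ ≤ M 3 ∧
          ‖Torus.partialDeriv i (Torus.partialDeriv j (Torus.partialDeriv k (Torus.partialDeriv l u))) x‖ ≤
            M 4) ∧
        (|u x c| ≤ M 0 ∧ |Torus.partialDeriv i (fun y => u y c) x| ≤ M 1 ∧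
          |Torus.partialDeriv i (Torus.partialDeriv j (fun y => u y c)) x| ≤ M 2 ∧
          |Torus.partialDeriv i (Torus.partialDeriv j (Torus.partialDeriv k (fun y => u y c))) x| ≤ M 3 ∧
          |Torus.partialDeriv i (Torus.partialDeriv j (Torus.partialDeriv k
            (Torus.partialDeriv l (fun y => u y c)))) x| ≤ M 4) := by
  intro u hu M hM x i j k l c
  have huc : Torus.IsSmooth (fun y => u y c) := hu.apply c
  have hMc : ∀ n : ℕ, n ≤ 4 → ∀ y : EuclideanSpace ℝ (Fin 3),
      ‖iteratedFDeriv ℝ n (Torus.lift (fun x => u x c)) y‖ ≤ M n :=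
    fun n hn y => (torus_norm_iteratedFDeriv_lift_coord_le hu c n y).trans (hM n hn y)
  refine ⟨⟨?_, ?_, ?_, ?_, ?_⟩, ?_, ?_, ?_, ?_, ?_⟩
  · simpa using torus_norm_iterPartialDeriv_le_of_lift_bound hu (hM 0 (by norm_num)) [] rfl x
  · simpa using torus_norm_iterPartialDeriv_le_of_lift_bound hu (hM 1 (by norm_num)) [i] rfl x
  · simpa using torus_norm_iterPartialDeriv_le_of_lift_bound hu (hM 2 (by norm_num)) [i, j] rfl x
  · simpa using torus_norm_iterPartialDeriv_le_of_lift_bound hu (hM 3 (by norm_num)) [i, j, k] rfl x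
  · simpa using torus_norm_iterPartialDeriv_le_of_lift_bound hu (hM 4 (by norm_num)) [i, j, k, l] rfl x
  · simpa using torus_norm_iterPartialDeriv_le_of_lift_bound huc (hMc 0 (by norm_num)) [] rfl x
  · simpa using torus_norm_iterPartialDeriv_le_of_lift_bound huc (hMc 1 (by norm_num)) [i] rfl x
  · simpa using torus_norm_iterPartialDeriv_le_of_lift_bound huc (hMc 2 (by norm_num)) [i, j] rfl x
  · simpa using torus_norm_iterPartialDeriv_le_of_lift_bound huc (hMc 3 (by norm_num)) [i, j, k] rfl x
  · simpa using torus_norm_iterPartialDeriv_le_of_lift_bound huc (hMc 4 (by norm_num)) [i, j, k, l] rfl x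

/-! ## Powers `a f^p` of a positive smooth function: Faà di Bruno on the lift -/

/-- `|p (p-1) ⋯ (p-k+1)| ≤ k!` for `|p| ≤ 1`. [folklore] -/
theorem abs_descPochhammer_eval_le_factorial :
    ∀ {p : ℝ}, |p| ≤ 1 → ∀ k : ℕ, |(descPochhammer ℝ k).eval p| ≤ k.factorial := by
  intro p hp k
  induction k with
  | zero => simp
  | succ k ih =>
      rw [descPochhammer_succ_right, Polynomial.eval_mul, abs_mul, Nat.factorial_succ, Nat.cast_mul,
        mul_comm ((k + 1 : ℕ) : ℝ)]
      refine mul_le_mul ih ?_ (abs_nonneg _) (Nat.cast_nonneg _)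
      simp only [Polynomial.eval_sub, Polynomial.eval_X, Polynomial.eval_natCast]
      rw [abs_le] at hp ⊢
      push_cast
      constructor <;> linarith [hp.1, hp.2]

/-- The iterated derivatives of `r ↦ a r^p` within `(0, ∞)`: `a · p(p-1)⋯(p-k+1) · r^{p-k}`
(Mathlib `Real.iter_deriv_rpow_const`). [folklore] -/
theorem iteratedDerivWithin_const_mul_rpow_Ioi :
    ∀ (a p : ℝ) (k : ℕ) {r : ℝ}, 0 < r →
      iteratedDerivWithin k (fun s : ℝ => a * s ^ p) (Ioi 0) r =
        a * ((descPochhammer ℝ k).eval p * r ^ (p - k)) := by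
  intro a p k r hr
  rw [iteratedDerivWithin_const_mul_field, iteratedDerivWithin_of_isOpen_eq_iterate isOpen_Ioi hr,
    Real.iter_deriv_rpow_const]

/-- **Powers on a floor**: for `0 < m ≤ r ≤ S'`, `|p| ≤ 1` and `i : ℕ`,
`r^{p-i} ≤ (1 + S') (1 + m⁻¹)^{i+1}`. [folklore] -/
theorem rpow_sub_nat_le_of_floor :
    ∀ {m S' r p : ℝ} (i : ℕ), 0 < m → m ≤ r → r ≤ S' → |p| ≤ 1 →
      r ^ (p - i) ≤ (1 + S') * (1 + m⁻¹) ^ (i + 1) := by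
  intro m S' r p i hm hmr hrS hp
  have hr : 0 < r := hm.trans_le hmr
  have hS : 0 ≤ S' := hr.le.trans hrS
  have hp1 : p ≤ 1 := (le_abs_self p).trans hp
  have hp2 : -1 ≤ p := (neg_le.2 ((neg_le_abs p).trans hp) : -1 ≤ p)
  have hmi : (1 : ℝ) ≤ 1 + m⁻¹ := le_add_of_nonneg_right (inv_nonneg.2 hm.le)
  rcases le_or_gt 0 (p - i) with he | he
  · -- nonnegative exponent: `r^e ≤ (1+S')^e ≤ 1 + S'`
    have h1 : r ^ (p - i) ≤ (1 + S') ^ (p - i) := Real.rpow_le_rpow hr.le (by linarith) he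
    have h2 : (1 + S') ^ (p - i) ≤ (1 + S') ^ (1 : ℝ) :=
      Real.rpow_le_rpow_of_exponent_le (by linarith) (by linarith [(Nat.cast_nonneg i : (0 : ℝ) ≤ i)])
    rw [Real.rpow_one] at h2
    exact (h1.trans h2).trans (le_mul_of_one_le_right (by linarith) (one_le_pow₀ hmi))
  · -- negative exponent: `r^e ≤ m^e = (m⁻¹)^{-e} ≤ (1+m⁻¹)^{-e} ≤ (1+m⁻¹)^{i+1}`
    have h1 : r ^ (p - i) ≤ m ^ (p - i) := Real.rpow_le_rpow_of_nonpos hm hmr he.le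
    have h2 : m ^ (p - i) = m⁻¹ ^ (-(p - i)) := by
      rw [Real.inv_rpow hm.le, Real.rpow_neg hm.le, inv_inv]
    have h3 : m⁻¹ ^ (-(p - i)) ≤ (1 + m⁻¹) ^ (-(p - i)) :=
      Real.rpow_le_rpow (inv_nonneg.2 hm.le) (by linarith) (by linarith)
    have h4 : (1 + m⁻¹) ^ (-(p - i)) ≤ (1 + m⁻¹) ^ ((i + 1 : ℕ) : ℝ) :=
      Real.rpow_le_rpow_of_exponent_le hmi (by push_cast; linarith)
    rw [Real.rpow_natCast] at h4
    rw [h2] at h1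
    exact ((h1.trans h3).trans h4).trans (le_mul_of_one_le_left (pow_nonneg (by linarith) _) (by linarith))

/-- **Fréchet bounds of `a f^p` on the lift** (Faà di Bruno in the form of Mathlib's
`norm_iteratedFDeriv_comp_le'`, outer function `r ↦ a r^p` on `(0, ∞)`): for smooth `f ≥ m > 0` on
`𝕋³` with `‖Dᵏ(f∘proj)‖ ≤ S` for all `k ≤ n`, and `|p| ≤ 1`,
`‖Dⁿ((a f^p)∘proj)‖ ≤ n! · (|a| n! (1+S)(1+m⁻¹)^{n+1}) · (1+S)ⁿ`. [folklore] -/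
theorem torus_norm_iteratedFDeriv_lift_const_mul_rpow_le :
    ∀ {f : T3 → ℝ}, Torus.IsSmooth f → ∀ {m S a p : ℝ} {n : ℕ}, 0 < m → (∀ x, m ≤ f x) → |p| ≤ 1 →
      (∀ k : ℕ, k ≤ n → ∀ y : EuclideanSpace ℝ (Fin 3), ‖iteratedFDeriv ℝ k (Torus.lift f) y‖ ≤ S) →
      ∀ y : EuclideanSpace ℝ (Fin 3),
        ‖iteratedFDeriv ℝ n (Torus.lift (fun x => a * f x ^ p)) y‖ ≤
          n.factorial * (|a| * n.factorial * (1 + S) * (1 + m⁻¹) ^ (n + 1)) * (1 + S) ^ n := by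
  intro f hf m S a p n hm hfl hp hS y
  have hS0 : 0 ≤ S := le_trans (norm_nonneg _) (hS 0 (Nat.zero_le n) y)
  have hmi : (1 : ℝ) ≤ 1 + m⁻¹ := le_add_of_nonneg_right (inv_nonneg.2 hm.le)
  -- the outer function and its derivatives on `(0, ∞)`
  have hg : ContDiffOn ℝ (n : ℕ∞ω) (fun s : ℝ => a * s ^ p) (Ioi 0) :=
    contDiffOn_const.mul ((contDiffOn_id (s := Ioi (0 : ℝ))).rpow_const_of_ne fun s hs => (ne_of_gt hs))
  have hfn : ContDiff ℝ (n : ℕ∞ω) (Torus.lift f) := hf.of_le (by exact_mod_cast le_top)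
  have hrange : Set.range (Torus.lift f) ⊆ Ioi 0 := by
    rintro _ ⟨z, rfl⟩
    exact hm.trans_le (hfl _)
  have hval : ∀ z : EuclideanSpace ℝ (Fin 3), m ≤ Torus.lift f z ∧ Torus.lift f z ≤ S := by
    intro z
    refine ⟨hfl _, ?_⟩
    have h0 := hS 0 (Nat.zero_le n) z
    rw [norm_iteratedFDeriv_zero, Real.norm_eq_abs] at h0
    exact (le_abs_self _).trans h0
  have hC : ∀ i, i ≤ n → ‖iteratedFDerivWithin ℝ i (fun s : ℝ => a * s ^ p) (Ioi 0) (Torus.lift f y)‖ ≤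
      |a| * n.factorial * (1 + S) * (1 + m⁻¹) ^ (n + 1) := by
    intro i hi
    have hr : 0 < Torus.lift f y := hm.trans_le (hval y).1
    rw [norm_iteratedFDerivWithin_eq_norm_iteratedDerivWithin, iteratedDerivWithin_const_mul_rpow_Ioi a p i hr,
      Real.norm_eq_abs, abs_mul, abs_mul, abs_of_pos (Real.rpow_pos_of_pos hr _)]
    have h1 := abs_descPochhammer_eval_le_factorial hp i
    have h2 := rpow_sub_nat_le_of_floor i hm (hval y).1 (hval y).2 hp
    have h3 : (i.factorial : ℝ) ≤ n.factorial := by exact_mod_cast Nat.factorial_le hi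
    have h4 : (1 + m⁻¹) ^ (i + 1) ≤ (1 + m⁻¹) ^ (n + 1) := pow_le_pow_right₀ hmi (by omega)
    calc |a| * (|(descPochhammer ℝ i).eval p| * Torus.lift f y ^ (p - i))
        ≤ |a| * (n.factorial * ((1 + S) * (1 + m⁻¹) ^ (n + 1))) := by
          refine mul_le_mul_of_nonneg_left ?_ (abs_nonneg a)
          exact mul_le_mul (h1.trans h3) (h2.trans (mul_le_mul_of_nonneg_left h4 (by linarith)))
            (Real.rpow_nonneg hr.le _) (Nat.cast_nonneg _)
      _ = |a| * n.factorial * (1 + S) * (1 + m⁻¹) ^ (n + 1) := by ring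
  have hD : ∀ i, 1 ≤ i → i ≤ n → ‖iteratedFDeriv ℝ i (Torus.lift f) y‖ ≤ (1 + S) ^ i := by
    intro i hi hin
    calc ‖iteratedFDeriv ℝ i (Torus.lift f) y‖ ≤ S := hS i hin y
      _ ≤ 1 + S := by linarith
      _ ≤ (1 + S) ^ i := le_self_pow₀ (by linarith) (by omega)
  have hcomp : Torus.lift (fun x => a * f x ^ p) = (fun s : ℝ => a * s ^ p) ∘ Torus.lift f := rfl
  rw [hcomp]
  exact norm_iteratedFDeriv_comp_le' hrange (uniqueDiffOn_Ioi 0) hg hfn le_rfl y hC hD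

/-- `a f^p` is smooth for smooth `f > 0`. [folklore] -/
theorem torus_isSmooth_const_mul_rpow :
    ∀ {f : T3 → ℝ}, Torus.IsSmooth f → (∀ x, 0 < f x) → ∀ (a p : ℝ),
      Torus.IsSmooth (fun x => a * f x ^ p) := by
  intro f hf hpos a p
  have h : ContDiff ℝ ∞ (fun y => a * Torus.lift f y ^ p) :=
    contDiff_const.mul (hf.rpow_const_of_ne fun y => (hpos _).ne')
  exact h

/-- The numerical envelope of the orders `n ≤ 4`:
`n! · |a| n!(1+S)(1+m⁻¹)^{n+1} · (1+S)ⁿ ≤ 576 |a| (1+S)⁵ (1+m⁻¹)⁵`. [folklore] -/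
theorem rpow_jet_const_le :
    ∀ {S m a : ℝ} {n : ℕ}, 0 ≤ S → 0 < m → n ≤ 4 →
      (n.factorial : ℝ) * (|a| * n.factorial * (1 + S) * (1 + m⁻¹) ^ (n + 1)) * (1 + S) ^ n ≤
        576 * |a| * (1 + S) ^ 5 * (1 + m⁻¹) ^ 5 := by
  intro S m a n hS hm hn
  have hmi : (1 : ℝ) ≤ 1 + m⁻¹ := le_add_of_nonneg_right (inv_nonneg.2 hm.le)
  have hf : (n.factorial : ℝ) ≤ 24 := by exact_mod_cast (Nat.factorial_le hn : n.factorial ≤ (4 : ℕ).factorial)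
  have h1 : (1 + S) ^ (n + 1) ≤ (1 + S) ^ 5 := pow_le_pow_right₀ (by linarith) (by omega)
  have h2 : (1 + m⁻¹) ^ (n + 1) ≤ (1 + m⁻¹) ^ 5 := pow_le_pow_right₀ hmi (by omega)
  have hf0 : (0 : ℝ) ≤ n.factorial := Nat.cast_nonneg _
  calc (n.factorial : ℝ) * (|a| * n.factorial * (1 + S) * (1 + m⁻¹) ^ (n + 1)) * (1 + S) ^ n
      = (n.factorial * n.factorial) * |a| * ((1 + S) ^ (n + 1) * (1 + m⁻¹) ^ (n + 1)) := by ring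
    _ ≤ (24 * 24) * |a| * ((1 + S) ^ 5 * (1 + m⁻¹) ^ 5) := by gcongr
    _ = 576 * |a| * (1 + S) ^ 5 * (1 + m⁻¹) ^ 5 := by ring

/-- **Jets of `a f^p` on a floor, orders `0–4`**: for smooth `f ≥ m > 0` on `𝕋³` with
`‖Dᵏ(f∘proj)‖ ≤ S` (`k ≤ 4`) and `|p| ≤ 1`, the function `a f^p` and all its nested partial derivatives
of orders `1–4` are bounded by `576 |a| (1+S)⁵ (1+m⁻¹)⁵`. [folklore] -/
theorem torus_rpow_jet_le_of_lift_bounds :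
    ∀ {f : T3 → ℝ}, Torus.IsSmooth f → ∀ {m S : ℝ} (a p : ℝ), 0 < m → (∀ x, m ≤ f x) → |p| ≤ 1 →
      (∀ k : ℕ, k ≤ 4 → ∀ y : EuclideanSpace ℝ (Fin 3), ‖iteratedFDeriv ℝ k (Torus.lift f) y‖ ≤ S) →
      ∀ (x : T3) (i j k l : Fin 3),
        |a * f x ^ p| ≤ 576 * |a| * (1 + S) ^ 5 * (1 + m⁻¹) ^ 5 ∧
        |Torus.partialDeriv i (fun x => a * f x ^ p) x| ≤ 576 * |a| * (1 + S) ^ 5 * (1 + m⁻¹) ^ 5 ∧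
        |Torus.partialDeriv i (Torus.partialDeriv j (fun x => a * f x ^ p)) x| ≤
          576 * |a| * (1 + S) ^ 5 * (1 + m⁻¹) ^ 5 ∧
        |Torus.partialDeriv i (Torus.partialDeriv j (Torus.partialDeriv k (fun x => a * f x ^ p))) x| ≤
          576 * |a| * (1 + S) ^ 5 * (1 + m⁻¹) ^ 5 ∧
        |Torus.partialDeriv i (Torus.partialDeriv j (Torus.partialDeriv k
          (Torus.partialDeriv l (fun x => a * f x ^ p)))) x| ≤ 576 * |a| * (1 + S) ^ 5 * (1 + m⁻¹) ^ 5 := by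
  intro f hf m S a p hm hfl hp hS x i j k l
  have hS0 : 0 ≤ S := le_trans (norm_nonneg _) (hS 0 (by norm_num) 0)
  have hg : Torus.IsSmooth (fun x => a * f x ^ p) :=
    torus_isSmooth_const_mul_rpow hf (fun x => hm.trans_le (hfl x)) a p
  have hB : ∀ n : ℕ, n ≤ 4 → ∀ y : EuclideanSpace ℝ (Fin 3),
      ‖iteratedFDeriv ℝ n (Torus.lift (fun x => a * f x ^ p)) y‖ ≤ 576 * |a| * (1 + S) ^ 5 * (1 + m⁻¹) ^ 5 :=
    fun n hn y => (torus_norm_iteratedFDeriv_lift_const_mul_rpow_le hf hm hfl hp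
      (fun k hk z => hS k (hk.trans hn) z) y).trans (rpow_jet_const_le hS0 hm hn)
  refine ⟨?_, torus_partialDeriv_iter_le_of_lift_bounds hg (M := fun _ => _) hB x i j k l⟩
  simpa using torus_norm_iterPartialDeriv_le_of_lift_bound hg (hB 0 (by norm_num)) [] rfl x

/-- **Jets of `f^p` on a floor, orders `0–4`** (the case `a = 1`): bound `576 (1+S)⁵ (1+m⁻¹)⁵`. [folklore] -/
theorem torus_rpow_jet_le_of_lift_bounds' :
    ∀ {f : T3 → ℝ}, Torus.IsSmooth f → ∀ {m S : ℝ} (p : ℝ), 0 < m → (∀ x, m ≤ f x) → |p| ≤ 1 →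
      (∀ k : ℕ, k ≤ 4 → ∀ y : EuclideanSpace ℝ (Fin 3), ‖iteratedFDeriv ℝ k (Torus.lift f) y‖ ≤ S) →
      ∀ (x : T3) (i j k l : Fin 3),
        |f x ^ p| ≤ 576 * (1 + S) ^ 5 * (1 + m⁻¹) ^ 5 ∧
        |Torus.partialDeriv i (fun x => f x ^ p) x| ≤ 576 * (1 + S) ^ 5 * (1 + m⁻¹) ^ 5 ∧
        |Torus.partialDeriv i (Torus.partialDeriv j (fun x => f x ^ p)) x| ≤ 576 * (1 + S) ^ 5 * (1 + m⁻¹) ^ 5 ∧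
        |Torus.partialDeriv i (Torus.partialDeriv j (Torus.partialDeriv k (fun x => f x ^ p))) x| ≤
          576 * (1 + S) ^ 5 * (1 + m⁻¹) ^ 5 ∧
        |Torus.partialDeriv i (Torus.partialDeriv j (Torus.partialDeriv k
          (Torus.partialDeriv l (fun x => f x ^ p)))) x| ≤ 576 * (1 + S) ^ 5 * (1 + m⁻¹) ^ 5 := by
  intro f hf m S p hm hfl hp hS x i j k l
  have h := torus_rpow_jet_le_of_lift_bounds hf 1 p hm hfl hp hS x i j k l
  have h1 : (fun x => (1 : ℝ) * f x ^ p) = fun x => f x ^ p := funext fun x => one_mul _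
  simpa only [h1, one_mul, abs_one, mul_one] using h

end Summit.AtomisticToContinuum.HydrodynamicLimit.Theorems

end
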